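import Summits.QuantumFields.BalabanUV.T4Continuum.Support.RegionGaugeColumnsTrace
import Summits.QuantumFields.BalabanUV.T4Continuum.Support.RegionGaugeResolventTowerRegion

/-!
# T⁴ programme, spine node NE2 (U1a), sub-row Δ1 «NE2⁰-Dirichlet» — LEAF (Bᵗ) FROM LEAF (B) ON ANY UNION OF UNIT BLOCKS, MODULO THE
# SCALAR BUDGET OF THE ZERO-EXTENDED REGION SOLUTION (the `hBt` socket of the owner's region reduction `hinjK_of_local_of_coercive`)

NE2 formalisation swarm `b2b-balaban-t4-ne2-formalise-*`, LEAF PROVER 06 (gen 7), supplier item «Δ1-VEC-BT-TRACE-REGION» (journal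
2026-08-20 l.23282), on this seat's box file `Support/RegionGaugeColumnsTrace` (p239685).  The row OWNER's O15-f
`RegionGaugeResolventTowerRegion.hinjK_of_local_of_coercive` (p240623) reduces King's compressed injected law of the faithful `Δ_a(Ω₀)` on ANY
union of unit blocks (given a level-uniform W1 constant) to the same four leaves (L) (B) (Bᵗ) (K) as on boxes — the first brick of the
RE-ENTRANT front (owner R37 (e) / R40 (c)).  The box proof of (Bᵗ) ⟸ (B) used the coordinate-box hypothesis at exactly ONE place: gan24's
corner-free `H²` budget `DirichletBoxTwoLevel.sum_budget_solExt_le`.  THIS FILE displays that budget instead: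

 * §1 ANY union `S`, any level `n ≥ 1`, `0 < a′`: with the SCALAR BUDGET of the zero-extended region solution displayed —
   `hΛ : ∀ f, Σ_μ budget M S n μ (solExt n M a′ (blockReg n M S) f) ≤ Λ·nsq f` (energy + interior DIAGONAL second differences; gan24's
   `budget`, generic in `S`) — **`sum_deficient_normSq_regionBh_le_of_budget`** `Σ_def ‖B̂c‖² ≤ 2Λ·‖c‖²/n` and
   **`opNorm_defP_mul_regionBh_le_of_budget`** `‖P_def·B̂‖ ≤ √(2Λ/n)` (gen 6's spike columns + `path_avg`: only diagonal interior second
   differences up each column, so no mixed Hessian and no corner term is ever needed BY THIS STEP — the re-entrant difficulty sits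
   entirely inside the displayed scalar budget `Λ`);
 * §2 ALONG THE STAR TOWER: **`hBt_of_hB_of_budget`** — with level budgets `Λ_k` and a rate `√(2Λ_k/n_k) ≤ CH·θ^k`, leaf (B) at rate `θ`
   gives leaf (Bᵗ) at rate `θ` with `Cbt = Cb + (1 − L⁻¹)·CH` — the owner's `hBt` VERBATIM (same shape in `hinjK_of_local` and in
   `hinjK_of_local_of_coercive`);
 * §2b **`hinjK_of_local_of_coercive_of_budget`** — the owner's O15-f region reduction `hinjK_of_local_of_coercive` (W1 + (L) (B) (Bᵗ) (K) on
   ANY union) with (Bᵗ) DISCHARGED: King's compressed injected law of the faithful `Δ_a(Ω₀)` on any union of blocks MODULO W1, (L), (B), (K)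
   and the scalar budget;
 * §3 K-TEST: on a coordinate box `Λ_k = Lam d a′` (gan24) and `CH = √(2·Lam d a′)`, `θ ≥ (√L)⁻¹` — **`hBt_of_hB_box'`** re-derives p239685's
   `hBt_of_hB` with the same constant `Cbt d L a′ Cb` through the general theorem.

HONEST FRAMING (T4-DAG p. 1).  [folklore] finite lattice calculus + linear algebra over landed modules (`U = 1`, ONE region = a union of unit
blocks, ONE averaging scale, finite torus, linear layer, operator norm); constants OURS; the scalar budget is DISPLAYED (a theorem on
coordinate boxes only — on re-entrant regions its level growth is the located open estimate of the next front, cf. gan24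
`DirichletBoxRegularityLocal`); (B) DISPLAYED; `hinjK` / W3 OPEN; Δ1 NOT closed; NE2 (U1a) NOT proved; spine PROVED 0/9 unchanged; NOT [B9]
(3.16)/(3.23)–(3.27)/(3.42) as printed; NOT infinite volume / mass gap / Clay.  HONEST DEPENDENCY: continuum YM on T⁴ ⇐ BetaPertH ∧ nine
spine estimates (0/9 proved); BetaPertH ⇐ (D1) ∧ (D4) ∧ CAP+tail; G-an2-4 gates asym, D1 and NE2/3/4.  No `sorry`.
-/

noncomputable section

open scoped BigOperators ComplexConjugate Matrix Matrix.Norms.L2Operator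
open Finset

namespace Summit.QuantumFields.BalabanUV.T4Continuum.RegionGaugeColumnsTraceRegion

open Literature.MathematicalPhysics.QuantumFieldTheory.Balaban1983to89.B5Prop11Plancherel (Tor fine unitVec)
open Literature.MathematicalPhysics.QuantumFieldTheory.Balaban1983to89.B5Prop11Lower (nsq nsq_nonneg)
open Literature.MathematicalPhysics.QuantumFieldTheory.Balaban1983to89.B5Action121 (sdiff)
open Literature.MathematicalPhysics.QuantumFieldTheory.Balaban1983to89.B5G183RateUnitTower (lev)
open Summit.QuantumFields.BalabanUV.T4Continuum
open Summit.QuantumFields.BalabanUV.T4Continuum.ScalarAveragedPropagator (gammaPs gammaPs_pos opNorm_le_of_nsq_le_rect)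
open Summit.QuantumFields.BalabanUV.T4Continuum.RegionScalarCompression (QOm)
open Summit.QuantumFields.BalabanUV.T4Continuum.RegionGaugeFixedVector (starReg)
open Summit.QuantumFields.BalabanUV.T4Continuum.DirichletSubregionTowerOf (pidx JpR)
open Summit.QuantumFields.BalabanUV.T4Continuum.DirichletStarVectorTower (starP)
open Summit.QuantumFields.BalabanUV.T4Continuum.DirichletStarRenormBoxTower (sqrt_inv_lev)
open Summit.QuantumFields.BalabanUV.T4Continuum.RegionStarTrace (cpt defSet mem_defSet sum_columns_le defP nsq_defP_mulVec)
open Summit.QuantumFields.BalabanUV.T4Continuum.SubtypeCompression (Coercive)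
open Summit.QuantumFields.BalabanUV.T4Continuum.RegionScalarCompression (KcompR)
open Summit.QuantumFields.BalabanUV.T4Continuum.RegionGaugeFixedVector (regionDeltaA)
open Summit.QuantumFields.BalabanUV.T4Continuum.RegionGaugeResolventSplit (regionBh regionDeltaLoc)
open Summit.QuantumFields.BalabanUV.T4Continuum.RegionGaugeResolventTowerRegion (C1reg hinjK_of_local_of_coercive)
open Summit.QuantumFields.BalabanUV.T4Continuum.RegionGaugeColumnsTrace (psiBar colU colF colF_nonneg sum_normSq_colU sum_colF spike_le
  nsq_QOm_conjTranspose_mulVec_le one_sub_inv_nonneg opNorm_adjoint_defect_le Cbt hBt_of_hB)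
open Summit.QuantumFields.BalabanUV.Beta.GAN24.DirichletBoxTrace (blockReg)
open Summit.QuantumFields.BalabanUV.Beta.GAN24.DirichletBoxRegularity (Pdir)
open Summit.QuantumFields.BalabanUV.Beta.GAN24.DirichletBoxCompression (solExt)
open Summit.QuantumFields.BalabanUV.Beta.GAN24.DirichletBoxTwoLevel (IsCoordBox budget Lam Lam_nonneg sum_budget_solExt_le)

variable {d : ℕ}

/-! ## §1 Any union of blocks: the deficient-layer trace of the gauge columns modulo the scalar budget -/

section Region

variable (n : ℕ) [NeZero n] (M : Fin d → ℕ) [hM : ∀ μ, NeZero (M μ)] (S : Tor M → Prop) [DecidablePred S] (a' : ℝ)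

/-- **THE DEFICIENT-LAYER TRACE OF THE GAUGE COLUMNS ON ANY UNION OF UNIT BLOCKS, MODULO THE SCALAR BUDGET**: if the zero-extended
region solutions obey `Σ_μ budget_μ(solExt f) ≤ Λ·‖f‖²` (energy + interior diagonal second differences), then `Σ_def ‖B̂c‖² ≤ 2Λ·‖c‖²/n`.
[folklore] -/
theorem sum_deficient_normSq_regionBh_le_of_budget {Λ : ℝ} (hΛ0 : 0 ≤ Λ)
    (hΛ : ∀ f : {x // blockReg n M S x} → ℂ, ∑ μ, budget M S n μ (solExt n M a' (blockReg n M S) f) ≤ Λ * nsq f)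
    (c : {y // S y} → ℂ) :
    ∑ b ∈ defSet n M S, ‖(regionBh n M a' S *ᵥ c) b‖ ^ 2 ≤ 2 * Λ * nsq c / n := by
  have hn0 : (0 : ℝ) < n := by exact_mod_cast Nat.pos_of_ne_zero (NeZero.ne n)
  have hnd : (0 : ℝ) ≤ (n : ℝ) ^ d := pow_nonneg (Nat.cast_nonneg n) d
  rw [le_div_iff₀ hn0, Finset.sum_mul]
  have h1 : ∑ b ∈ defSet n M S, ‖(regionBh n M a' S *ᵥ c) b‖ ^ 2 * n
      ≤ ∑ b ∈ defSet n M S, (2 * ∑ s ∈ range n, ‖colU n M S a' c (cpt n M b.1 s)‖ ^ 2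
          + (n : ℝ) ^ d * ∑ s ∈ range n, colF n M S a' c (cpt n M b.1 s)) :=
    sum_le_sum fun b hb => by rw [mul_comm]; exact spike_le n M S a' c b ((mem_defSet n M S).mp hb)
  have h2 : ∑ b ∈ defSet n M S, ∑ s ∈ range n, ‖colU n M S a' c (cpt n M b.1 s)‖ ^ 2
      ≤ (n : ℝ) ^ d * ∑ μ, nsq (sdiff (fine n M) (n : ℂ) μ *ᵥ psiBar n M S a' c) := by
    rw [← sum_normSq_colU]
    exact sum_columns_le n M S (fun bb => ‖colU n M S a' c bb‖ ^ 2) fun bb => by positivity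
  have h3 : ∑ b ∈ defSet n M S, ∑ s ∈ range n, colF n M S a' c (cpt n M b.1 s)
      ≤ ∑ μ, ∑ x ∈ univ.filter (blockReg n M S), ‖(Pdir (fine n M) (n : ℂ) μ *ᵥ psiBar n M S a' c) x‖ ^ 2 := by
    rw [← sum_colF]
    exact sum_columns_le n M S (colF n M S a' c) (colF_nonneg n M S a' c)
  have h4 : ∑ μ, budget M S n μ (psiBar n M S a' c) ≤ Λ * nsq ((QOm n M S)ᴴ *ᵥ c) := hΛ ((QOm n M S)ᴴ *ᵥ c)
  have h5 : ∑ μ, budget M S n μ (psiBar n M S a' c) = ∑ μ, nsq (sdiff (fine n M) (n : ℂ) μ *ᵥ psiBar n M S a' c)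
      + ∑ μ, ∑ x ∈ univ.filter (blockReg n M S), ‖(Pdir (fine n M) (n : ℂ) μ *ᵥ psiBar n M S a' c) x‖ ^ 2 := by
    rw [← Finset.sum_add_distrib]; rfl
  have h6 := nsq_QOm_conjTranspose_mulVec_le n M S c
  rw [sum_add_distrib, ← mul_sum, ← mul_sum] at h1
  have h7 : (n : ℝ) ^ d * (Λ * nsq ((QOm n M S)ᴴ *ᵥ c)) ≤ Λ * nsq c := by
    rw [mul_left_comm]; exact mul_le_mul_of_nonneg_left h6 hΛ0
  set A := ∑ b ∈ defSet n M S, ∑ s ∈ range n, ‖colU n M S a' c (cpt n M b.1 s)‖ ^ 2 with hA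
  set B := ∑ b ∈ defSet n M S, ∑ s ∈ range n, colF n M S a' c (cpt n M b.1 s) with hB
  set D := ∑ μ, nsq (sdiff (fine n M) (n : ℂ) μ *ᵥ psiBar n M S a' c) with hD
  set H := ∑ μ, ∑ x ∈ univ.filter (blockReg n M S), ‖(Pdir (fine n M) (n : ℂ) μ *ᵥ psiBar n M S a' c) x‖ ^ 2 with hH
  have hH0 : 0 ≤ H := sum_nonneg fun μ _ => sum_nonneg fun x _ => by positivity
  have hDH : D + H ≤ Λ * nsq ((QOm n M S)ᴴ *ᵥ c) := by have h := h4; rw [h5] at h; exact h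
  have h8 : (n : ℝ) ^ d * D + (n : ℝ) ^ d * H ≤ (n : ℝ) ^ d * (Λ * nsq ((QOm n M S)ᴴ *ᵥ c)) := by
    rw [← mul_add]; exact mul_le_mul_of_nonneg_left hDH hnd
  have h9 : (n : ℝ) ^ d * B ≤ (n : ℝ) ^ d * H := mul_le_mul_of_nonneg_left h3 hnd
  have h10 : 0 ≤ (n : ℝ) ^ d * H := mul_nonneg hnd hH0
  linarith [h1, h2, h7, h8, h9, h10]

/-- **`‖P_def·B̂‖ ≤ √(2Λ/n)` ON ANY UNION OF BLOCKS, MODULO THE SCALAR BUDGET `Λ`.** [folklore] -/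
theorem opNorm_defP_mul_regionBh_le_of_budget {Λ : ℝ} (hΛ0 : 0 ≤ Λ)
    (hΛ : ∀ f : {x // blockReg n M S x} → ℂ, ∑ μ, budget M S n μ (solExt n M a' (blockReg n M S) f) ≤ Λ * nsq f) :
    ‖defP n M S * regionBh n M a' S‖ ≤ Real.sqrt (2 * Λ / n) := by
  have hn0 : (0 : ℝ) < n := by exact_mod_cast Nat.pos_of_ne_zero (NeZero.ne n)
  refine opNorm_le_of_nsq_le_rect _ (Real.sqrt_nonneg _) fun c => ?_
  rw [Real.sq_sqrt (by positivity), ← Matrix.mulVec_mulVec, nsq_defP_mulVec]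
  calc ∑ b ∈ defSet n M S, ‖(regionBh n M a' S *ᵥ c) b‖ ^ 2 ≤ 2 * Λ * nsq c / n :=
        sum_deficient_normSq_regionBh_le_of_budget n M S a' hΛ0 hΛ c
    _ = 2 * Λ / n * nsq c := by ring

end Region

/-! ## §2 Along the star tower of any union: (Bᵗ) from (B) and the level budgets -/

section Tower

variable (L : ℕ) [NeZero L] (M : Fin d → ℕ) [hM : ∀ μ, NeZero (M μ)] (S : Tor M → Prop) [DecidablePred S] (a' : ℝ)

/-- **LEAF (Bᵗ) FROM LEAF (B) ON ANY UNION OF UNIT BLOCKS**: with level budgets `Λ_k ≥ 0` of the zero-extended region solutions and a rate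
`√(2Λ_k/n_k) ≤ CH·θ^k`, `‖B̂_{k+1} − J_k·B̂_k‖ ≤ Cb·θ^k` ⟹ `‖J_kᴴ·B̂_{k+1} − B̂_k‖ ≤ (Cb + (1 − L⁻¹)·CH)·θ^k` — the owner's `hBt` VERBATIM
(`hinjK_of_local` / `hinjK_of_local_of_coercive`). [folklore] -/
theorem hBt_of_hB_of_budget (hL : 1 ≤ L) {Λ : ℕ → ℝ} (hΛ0 : ∀ k, 0 ≤ Λ k)
    (hΛ : ∀ (k : ℕ) (f : {x // blockReg (lev L k) M S x} → ℂ),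
      ∑ μ, budget M S (lev L k) μ (solExt (lev L k) M a' (blockReg (lev L k) M S) f) ≤ Λ k * nsq f)
    {θ CH Cb : ℝ} (hrate : ∀ k, Real.sqrt (2 * Λ k / ((lev L k : ℕ) : ℝ)) ≤ CH * θ ^ k)
    (hB : ∀ k, ‖regionBh (lev L (k + 1)) M a' S - JpR L M (starP L M S) k * regionBh (lev L k) M a' S‖ ≤ Cb * θ ^ k) (k : ℕ) :
    ‖(JpR L M (starP L M S) k)ᴴ * regionBh (lev L (k + 1)) M a' S - regionBh (lev L k) M a' S‖ ≤ (Cb + (1 - (L : ℝ)⁻¹) * CH) * θ ^ k := by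
  have h1 := one_sub_inv_nonneg L hL
  have htr := (opNorm_defP_mul_regionBh_le_of_budget (lev L k) M S a' (hΛ0 k) (hΛ k)).trans (hrate k)
  calc ‖(JpR L M (starP L M S) k)ᴴ * regionBh (lev L (k + 1)) M a' S - regionBh (lev L k) M a' S‖
      ≤ ‖regionBh (lev L (k + 1)) M a' S - JpR L M (starP L M S) k * regionBh (lev L k) M a' S‖
          + (1 - (L : ℝ)⁻¹) * ‖defP (lev L k) M S * regionBh (lev L k) M a' S‖ :=
        opNorm_adjoint_defect_le L M S hL k _ _
    _ ≤ Cb * θ ^ k + (1 - (L : ℝ)⁻¹) * (CH * θ ^ k) := by gcongr; exact hB k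
    _ = (Cb + (1 - (L : ℝ)⁻¹) * CH) * θ ^ k := by ring

/-- **THE OWNER's REGION REDUCTION WITH (Bᵗ) DISCHARGED**: on ANY union of unit blocks with a level-uniform W1 constant `γ` for
`Δ_a(Ω₀)`, the scalar level budgets `Λ_k` (rate `√(2Λ_k/n_k) ≤ CH·θ^k`), leaf (L), leaf (B) and leaf (K) at rate `θ ≥ 0` give King's
compressed injected law of the faithful `Δ_a(Ω₀)` with constant `C1reg d a′ γ Cl Cb (Cb + (1 − L⁻¹)·CH) Ck` — O15-f's
`hinjK_of_local_of_coercive` with `hBt := hBt_of_hB_of_budget`. [folklore] -/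
theorem hinjK_of_local_of_coercive_of_budget (hL : 1 ≤ L) (a : ℝ) (ha' : 0 < a') {γ : ℝ} (hγ : 0 < γ)
    (hco : ∀ k, Coercive (regionDeltaA (lev L k) M a a' S) γ)
    {Λ : ℕ → ℝ} (hΛ0 : ∀ k, 0 ≤ Λ k)
    (hΛ : ∀ (k : ℕ) (f : {x // blockReg (lev L k) M S x} → ℂ),
      ∑ μ, budget M S (lev L k) μ (solExt (lev L k) M a' (blockReg (lev L k) M S) f) ≤ Λ k * nsq f)
    {θ CH Cl Cb Ck : ℝ} (hθ : 0 ≤ θ) (hCb : 0 ≤ Cb) (hrate : ∀ k, Real.sqrt (2 * Λ k / ((lev L k : ℕ) : ℝ)) ≤ CH * θ ^ k)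
    (hloc : ∀ k, ‖(regionDeltaLoc (lev L (k + 1)) M a S)⁻¹ * JpR L M (starP L M S) k
        - JpR L M (starP L M S) k * (regionDeltaLoc (lev L k) M a S)⁻¹‖ ≤ Cl * θ ^ k)
    (hB : ∀ k, ‖regionBh (lev L (k + 1)) M a' S - JpR L M (starP L M S) k * regionBh (lev L k) M a' S‖ ≤ Cb * θ ^ k)
    (hK : ∀ k, ‖(KcompR (lev L (k + 1)) M a' S)⁻¹ - (KcompR (lev L k) M a' S)⁻¹‖ ≤ Ck * θ ^ k) (k : ℕ) :
    ‖(regionDeltaA (lev L (k + 1)) M a a' S)⁻¹ * JpR L M (starP L M S) k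
        - JpR L M (starP L M S) k * (regionDeltaA (lev L k) M a a' S)⁻¹‖
      ≤ C1reg d a' γ Cl Cb (Cb + (1 - (L : ℝ)⁻¹) * CH) Ck * θ ^ k :=
  hinjK_of_local_of_coercive L M S a a' ha' hγ hco hθ hCb hloc hB (hBt_of_hB_of_budget L M S a' hL hΛ0 hΛ hrate hB) hK k

/-! ## §3 K-test: the coordinate box through the general theorem -/

/-- **K-TEST (coordinate box)**: `Λ_k = Lam d a′` (gan24's corner-free budget), `CH = √(2·Lam d a′)`, `θ ≥ (√L)⁻¹` — the general theorem
returns p239685's `hBt_of_hB` with the same constant `Cbt d L a′ Cb`. [folklore] -/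
theorem hBt_of_hB_box' (hL : 1 ≤ L) (hS : IsCoordBox M S) (ha' : 0 < a') {θ Cb : ℝ} (hθ : (Real.sqrt L)⁻¹ ≤ θ)
    (hB : ∀ k, ‖regionBh (lev L (k + 1)) M a' S - JpR L M (starP L M S) k * regionBh (lev L k) M a' S‖ ≤ Cb * θ ^ k) (k : ℕ) :
    ‖(JpR L M (starP L M S) k)ᴴ * regionBh (lev L (k + 1)) M a' S - regionBh (lev L k) M a' S‖ ≤ Cbt d L a' Cb * θ ^ k := by
  have hΛ : 0 ≤ 2 * Lam d a' := by have := Lam_nonneg (d := d) a'; positivity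
  have hs0 : 0 ≤ (Real.sqrt L)⁻¹ := inv_nonneg.mpr (Real.sqrt_nonneg _)
  have hrate : ∀ j, Real.sqrt (2 * Lam d a' / ((lev L j : ℕ) : ℝ)) ≤ Real.sqrt (2 * Lam d a') * θ ^ j := by
    intro j
    rw [div_eq_mul_inv, Real.sqrt_mul hΛ, sqrt_inv_lev L j]
    exact mul_le_mul_of_nonneg_left (pow_le_pow_left₀ hs0 hθ j) (Real.sqrt_nonneg _)
  have h := hBt_of_hB_of_budget L M S a' hL (Λ := fun _ => Lam d a') (fun _ => Lam_nonneg (d := d) a')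
    (fun j f => sum_budget_solExt_le M S hS (lev L j) ha' (blockReg (lev L j) M S) (fun _ => Iff.rfl) f) hrate hB k
  unfold Cbt
  exact h

/-- consistency: the box constant of §3 IS p239685's (definitional). [folklore] -/
example (hL : 1 ≤ L) (hS : IsCoordBox M S) (ha' : 0 < a') {θ Cb : ℝ} (hθ : (Real.sqrt L)⁻¹ ≤ θ)
    (hB : ∀ k, ‖regionBh (lev L (k + 1)) M a' S - JpR L M (starP L M S) k * regionBh (lev L k) M a' S‖ ≤ Cb * θ ^ k) (k : ℕ) :
    ‖(JpR L M (starP L M S) k)ᴴ * regionBh (lev L (k + 1)) M a' S - regionBh (lev L k) M a' S‖ ≤ Cbt d L a' Cb * θ ^ k :=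
  hBt_of_hB L M S a' hL hS ha' hθ hB k

end Tower

end Summit.QuantumFields.BalabanUV.T4Continuum.RegionGaugeColumnsTraceRegion

end
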